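import Literature.AnabelianGeometry.AbsoluteAnabelian.AbsTopII.InertiaDecompositionProducts

/-!
# Kernel DAG index — layer X = MIXED delta (L4 ×2; one file per cycle under the live-queue discipline), part b (GENERATED by abc-iut-c312-2 gen 4 `work/gen_index.py` @2026-08-26T06:29Z from HOME/plan/DAG.tsv +
KERNEL-DAG-MODULES.tsv (regenerated 2026-08-26T06:00:22Z): 2 landed/discharged nodes NOT YET in the tree index Summits/ABC/IUTFork/DAG*.lean; spec v1.3 §2 (M))

THIS FILE PROVES NOTHING NEW AND ASSERTS NOTHING (HOME/plan/KERNEL-DAG-SPEC.md). It gives ONE NAME `N_<kernel_id>` to each DAG node whose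
statement has LANDED through the gate, knitting the landed declarations BY NAME: claim nodes `N_<id> : Prop := StatementOf @thm₁ ∧ …` (one
conjunct per landed theorem the DAG row names, universe levels instantiated explicitly per the spec's UNIVERSE RULE, arities read off the farm),
witnessed `N_<id>_holds` iff the DAG row is `discharged(p…)` and `N_<id>_part` otherwise (spec §2(b),(c); c312-2 F1/F2); data nodes
`abbrev N_<id> := @<primary>` with the row's further declarations as `example := @…` lines; FACT-style `def … : Prop` declarations are data
here (a NAME, never asserted). Decl lists come from the `decls` column of plan/DAG.tsv as resolved against the tree sources (unresolvable
tokens dropped and reported to abc-iut-dag on STATUS). Nothing here says abc is proved or refuted or takes a side on [IUTchIII] Cor 3.12.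
typed ≠ discharged; indexed ≠ endorsed.
-/

namespace Summit.ABC.IUTFork.DAG

namespace PartXb
/-- `StatementOf h` is the statement (a `Prop`) of which the landed `h` is the proof: the index NAMES statements, it never re-types them. -/
abbrev StatementOf {P : Prop} (_h : P) : Prop := P
end PartXb
open PartXb

noncomputable section
universe u₁ u₂ u₃ u₄ u₅ u₆ u₇ u₈ u₉ u₁₀ u₁₁ u₁₂ u₁₃ u₁₄ u₁₅ u₁₆


/-- [node AbsTopII:Prop1.3/iii.2 · L4/ · p.13 · p427149 · claim · DAG status discharged(p427149)] decls 2 · sub-DAG row, kernel_id synthesised by c312-2's rule (INBOX 03:0xZ) pending dag adoption · cites→ iii.1, I-surj -/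
def N_AbsTopII_Prop1_3_iii_2 : Prop :=
  StatementOf @Literature.AnabelianGeometry.AbsoluteAnabelian.DPSCData.isInternalProduct_Iv_vertSub.{u₁} ∧
  StatementOf @Literature.AnabelianGeometry.AbsoluteAnabelian.inf_eq_sup_of_sup_eq.{u₁}
/-- discharge of `N_AbsTopII_Prop1_3_iii_2`: the landed theorems it names, BY NAME (spec §2(c)); proves nothing new. -/
theorem N_AbsTopII_Prop1_3_iii_2_holds : N_AbsTopII_Prop1_3_iii_2 := ⟨@Literature.AnabelianGeometry.AbsoluteAnabelian.DPSCData.isInternalProduct_Iv_vertSub, @Literature.AnabelianGeometry.AbsoluteAnabelian.inf_eq_sup_of_sup_eq⟩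

/-- [node AbsTopII:Prop1.3/iii.3 · L4/ · p.13 · p427149 · claim · DAG status discharged(p427149)] decls 1 · sub-DAG row, kernel_id synthesised by c312-2's rule (INBOX 03:0xZ) pending dag adoption · cites→ I-C12ii (cusps), I-cuspconj, iii.1, I-surj -/
abbrev N_AbsTopII_Prop1_3_iii_3 : Prop := StatementOf @Literature.AnabelianGeometry.AbsoluteAnabelian.DPSCData.isInternalProduct_IvCusp.{u₁}
/-- discharge of `N_AbsTopII_Prop1_3_iii_3`: the landed theorems it names, BY NAME (spec §2(c)); proves nothing new. -/
theorem N_AbsTopII_Prop1_3_iii_3_holds : N_AbsTopII_Prop1_3_iii_3 := @Literature.AnabelianGeometry.AbsoluteAnabelian.DPSCData.isInternalProduct_IvCusp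

end

end Summit.ABC.IUTFork.DAG
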